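import Literature.Analysis.UnboundedOperators.LinearizedBoltzmannAction
import Literature.Analysis.UnboundedOperators.LinearizedBoltzmannSpectralGapProofs
import Mathlib.Analysis.Distribution.AEEqOfIntegralContDiff
import HarnessLib

/-!
# The energy form of the linearised hard-sphere operator: coercivity and auxiliary identities

Sibling proof file of `LinearizedBoltzmann.lean`, first half of the `L²(M dv)` invertibility of
the linearised hard-sphere operator `L = -ν + K` on the orthogonal complement of the collision
invariants (CIP 1994 §7.2: Fredholm alternative for `L h = g`, the input of the Chapman–Enskog
expansion). Everything here is at function level or about Mathlib's `Lp ℝ 2 (stdGaussian E)`;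
no new definitions are introduced. Contents:

* `neg_maxwellianInner_hardSphereLinearizedOp_eq` — the *energy identity*
  `-⟪t, L t⟫_M = ∫ ν t² dM - ⟪t, K t⟫_M` for `t` of temperate growth (Grad's splitting);
* `exists_energy_coercive` — **coercivity of the energy form**: with the spectral gap `λ`
  (`le_neg_maxwellianInner_hardSphereLinearizedOp_of_orthogonal_holds`) and the bound
  `|⟪t, K t⟫_M| ≤ C_K ‖t‖²` (`abs_linearizedKernelForm_le`), for every temperate `t ⊥_M` the
  collision invariants, `-⟪t, L t⟫_M ≥ λ ‖t‖²_M` and `-⟪t, L t⟫_M ≥ c ∫ ν t² dM`,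
  `c = λ / (λ + C_K) ∈ (0, 1]` (the convex combination of the two lower bounds);
* `gainLossOp_toLp_of_mem_collisionInvariants` — `K [n] = [ν n]` for a collision invariant `n`
  (`L n = 0`);
* `exists_sub_mem_collisionInvariants_orthogonal` — every `φ ∈ L²(M dv)` differs from a collision
  invariant `n` by a function `M`-orthogonal to all collision invariants (orthogonal projection
  onto the finite-dimensional space of invariant classes);
* `exists_clm_mul` — multiplication by a bounded measurable function as a bounded operator on
  `Lp ℝ 2 μ` (used with `ν^{-1/2}`), and `Lp_eq_zero_of_forall_integral_mul_eq_zero` — a class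
  `z ∈ L²(M dv)` with `∫ φ w z dM = 0` for all smooth compactly supported `φ` and a nowhere
  vanishing weight `w ∈ L²(M dv)` is zero (`ae_eq_zero_of_integral_contDiff_smul_eq_zero`).

## References

* C. Cercignani, R. Illner, M. Pulvirenti, *The Mathematical Theory of Dilute Gases*, Springer
  (1994), §7.2, Thm 7.2.1 and the Fredholm discussion after Thm 7.2.5, pp. 197–201.
* H. Grad, *Asymptotic theory of the Boltzmann equation II*, Rarefied Gas Dynamics I (1963) §4.
-/

open MeasureTheory Metric Real Set Filter Topology ProbabilityTheory Module
open scoped InnerProductSpace ENNReal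

namespace Literature.Analysis.UnboundedOperators

noncomputable section

open Literature.MathematicalPhysics.KineticTheory (collide sphereMeasure hardSphereKernel)
open Literature.Analysis.FluidPDE

/-! ### Multiplication operators on `L²` and a distributional uniqueness lemma -/

section Generic

variable {α : Type*} [MeasurableSpace α]

/-- **Multiplication by a bounded measurable function is a bounded operator on `L²(μ)`**: for
measurable `m` with `|m| ≤ C` there is `M ∈ B(L²(μ))` with `M f = m f` a.e. for every `f`
(realised through `MemLp.toLp` and `LinearMap.mkContinuous`; stated as an existence result).
[folklore] -/
theorem exists_clm_mul (μ : Measure α) {m : α → ℝ} (hm : Measurable m) {C : ℝ}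
    (hC : ∀ x, |m x| ≤ C) :
    ∃ M : Lp ℝ 2 μ →L[ℝ] Lp ℝ 2 μ, ∀ f : Lp ℝ 2 μ,
      (M f : α → ℝ) =ᵐ[μ] fun x => m x * (f : α → ℝ) x := by
  have hle : ∀ f : Lp ℝ 2 μ, ∀ᵐ x ∂μ, ‖m x * (f : α → ℝ) x‖ ≤ |C| * ‖(f : α → ℝ) x‖ :=
    fun f => Eventually.of_forall fun x => by
      rw [Real.norm_eq_abs, abs_mul, Real.norm_eq_abs]
      exact mul_le_mul_of_nonneg_right ((hC x).trans (le_abs_self C)) (abs_nonneg _)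
  have hmem : ∀ f : Lp ℝ 2 μ, MemLp (fun x => m x * (f : α → ℝ) x) 2 μ := fun f =>
    (Lp.memLp f).of_le_mul (hm.aestronglyMeasurable.mul (Lp.aestronglyMeasurable f)) (hle f)
  let L : Lp ℝ 2 μ →ₗ[ℝ] Lp ℝ 2 μ :=
    { toFun := fun f => (hmem f).toLp _
      map_add' := fun f g => by
        rw [← MemLp.toLp_add (hmem f) (hmem g)]
        refine MemLp.toLp_congr _ _ ?_
        filter_upwards [Lp.coeFn_add f g] with x hx
        simp only [hx, Pi.add_apply]
        ring
      map_smul' := fun c f => by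
        rw [RingHom.id_apply, ← MemLp.toLp_const_smul c (hmem f)]
        refine MemLp.toLp_congr _ _ ?_
        filter_upwards [Lp.coeFn_smul c f] with x hx
        simp only [hx, Pi.smul_apply, smul_eq_mul]
        ring }
  have hbound : ∀ f, ‖L f‖ ≤ |C| * ‖f‖ := fun f => by
    change ‖(hmem f).toLp _‖ ≤ |C| * ‖f‖
    rw [Lp.norm_toLp, Lp.norm_def]
    have h := eLpNorm_le_mul_eLpNorm_of_ae_le_mul (hle f) 2
    have hfin : ENNReal.ofReal |C| * eLpNorm (f : α → ℝ) 2 μ ≠ ∞ :=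
      ENNReal.mul_ne_top ENNReal.ofReal_ne_top (Lp.memLp f).eLpNorm_ne_top
    have := ENNReal.toReal_mono hfin h
    rwa [ENNReal.toReal_mul, ENNReal.toReal_ofReal (abs_nonneg C)] at this
  refine ⟨L.mkContinuous |C| hbound, fun f => ?_⟩
  rw [LinearMap.mkContinuous_apply]
  exact MemLp.coeFn_toLp (hmem f)

end Generic

variable {E : Type*} [NormedAddCommGroup E] [InnerProductSpace ℝ E] [FiniteDimensional ℝ E]
  [MeasurableSpace E] [BorelSpace E]

/-- **Distributional uniqueness in `L²(M dv)` with a weight**: if `z ∈ L²(M dv)`, `w ∈ L²(M dv)`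
vanishes nowhere and `∫ φ w z dM = 0` for all smooth compactly supported `φ`, then `z = 0`
(`w z ∈ L¹(M dv)` is locally integrable, so `w z = 0` a.e. by
`ae_eq_zero_of_integral_contDiff_smul_eq_zero`). [folklore] -/
theorem Lp_eq_zero_of_forall_integral_mul_eq_zero {z : Lp ℝ 2 (stdGaussian E)} {w : E → ℝ}
    (hw : MemLp w 2 (stdGaussian E)) (hw0 : ∀ v, w v ≠ 0)
    (h : ∀ φ : E → ℝ, ContDiff ℝ (⊤ : ℕ∞) φ → HasCompactSupport φ →
      ∫ v, φ v * (w v * (z : E → ℝ) v) ∂stdGaussian E = 0) : z = 0 := by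
  have hint : Integrable (fun v => w v * (z : E → ℝ) v) (stdGaussian E) :=
    hw.integrable_mul (Lp.memLp z)
  have hae := ae_eq_zero_of_integral_contDiff_smul_eq_zero hint.locallyIntegrable
    (fun φ hφ hsupp => by simpa only [smul_eq_mul] using h φ hφ hsupp)
  refine (Lp.eq_zero_iff_ae_eq_zero).2 ?_
  filter_upwards [hae] with v hv
  rcases mul_eq_zero.1 hv with h0 | h0
  · exact absurd h0 (hw0 v)
  · exact h0

/-! ### The energy identity and coercivity -/

/-- `⟪K [t], [t]⟫ = ⟪t, K t⟫_M` on representatives. [folklore] -/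
theorem inner_gainLossOp_toLp_self (hE : 2 ≤ finrank ℝ E) {t : E → ℝ}
    (ht : MemLp t 2 (stdGaussian E)) :
    ⟪gainLossOp hE (ht.toLp t), ht.toLp t⟫_ℝ = linearizedKernelForm t t := by
  rw [inner_gainLossOp]
  exact linearizedKernelForm_congr_ae (MemLp.coeFn_toLp _) (MemLp.coeFn_toLp _)

/-- **The energy identity** (Grad's splitting read in the quadratic form): for `t` of temperate
growth, `-⟪t, L t⟫_M = ∫ ν t² dM - ⟪t, K t⟫_M` (CIP 1994 §7.2 (2.14), `L = K - νI`).
[cite: CIPDiluteGases1994, §7.2 (2.14)] -/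
theorem neg_maxwellianInner_hardSphereLinearizedOp_eq (hE : 2 ≤ finrank ℝ E) {t : E → ℝ}
    (ht : t.HasTemperateGrowth) :
    -maxwellianInner t (hardSphereLinearizedOp t) =
      (∫ v, collisionFrequency v * t v ^ 2 ∂stdGaussian E) - linearizedKernelForm t t := by
  have htL : MemLp t 2 (stdGaussian E) := memLp_two_of_hasTemperateGrowth ht
  have hK := memLp_two_kernelAction (E := E) ht
  have hν := memLp_two_collisionFrequency_mul_of_hasTemperateGrowth (E := E) ht
  have i1 : Integrable (fun v => t v * (∫ w, ∫ ω, hardSphereKernel (v, w) ω *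
      (t (collide ω (v, w)).1 + t (collide ω (v, w)).2 - t w) ∂sphereMeasure ∂stdGaussian E))
      (stdGaussian E) := htL.integrable_mul hK
  have i2 : Integrable (fun v => t v * (collisionFrequency v * t v)) (stdGaussian E) :=
    htL.integrable_mul hν
  rw [linearizedKernelForm_eq_integral hE ht htL, maxwellianInner]
  have hpt : ∀ v, t v * hardSphereLinearizedOp t v =
      t v * (∫ w, ∫ ω, hardSphereKernel (v, w) ω *
        (t (collide ω (v, w)).1 + t (collide ω (v, w)).2 - t w) ∂sphereMeasure ∂stdGaussian E) -
      t v * (collisionFrequency v * t v) := fun v => by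
    rw [hardSphereLinearizedOp_eq_kernel_sub ht v]; ring
  rw [integral_congr_ae (Eventually.of_forall hpt), integral_sub i1 i2]
  have h2 : ∫ v, t v * (collisionFrequency v * t v) ∂stdGaussian E =
      ∫ v, collisionFrequency v * t v ^ 2 ∂stdGaussian E :=
    integral_congr_ae (Eventually.of_forall fun v => by ring)
  rw [h2]
  ring

omit [BorelSpace E] in
/-- `‖[t]‖² = ⟪t, t⟫_M`. [folklore] -/
theorem norm_toLp_sq_eq_maxwellianInner {t : E → ℝ} (ht : MemLp t 2 (stdGaussian E)) :
    ‖ht.toLp t‖ ^ 2 = maxwellianInner t t := by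
  rw [← real_inner_self_eq_norm_sq, L2.inner_def, maxwellianInner]
  refine integral_congr_ae ?_
  filter_upwards [MemLp.coeFn_toLp ht] with v hv
  rw [hv]
  simp only [RCLike.inner_apply, conj_trivial]

/-- **Coercivity of the energy form.** In dimension `d ≥ 2` there are `λ > 0` (the spectral gap)
and `c ∈ (0, 1]` such that for every `t` of temperate growth `M`-orthogonal to the collision
invariants, `-⟪t, L t⟫_M ≥ λ ⟪t, t⟫_M` and `-⟪t, L t⟫_M ≥ c ∫ ν t² dM`: the second bound is the
convex combination of the gap with `-⟪t, L t⟫_M ≥ ∫ ν t² - C_K ⟪t, t⟫_M` (`K ∈ B(L²)`), with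
`c = λ / (λ + C_K)`. This is the coercivity of Grad's energy form `∫ ν u u' - ⟪u, K u'⟫` on the
orthogonal complement of the null space (CIP 1994 §7.2, proof of Thm 7.2.5 / Fredholm property).
[cite: CIPDiluteGases1994, §7.2 Thm 7.2.5] -/
theorem exists_energy_coercive (hE : 2 ≤ finrank ℝ E) :
    ∃ lam c : ℝ, 0 < lam ∧ 0 < c ∧ c ≤ 1 ∧ ∀ t : E → ℝ, t.HasTemperateGrowth →
      (∀ φ ∈ collisionInvariants E, maxwellianInner t φ = 0) →
      lam * maxwellianInner t t ≤
          (∫ v, collisionFrequency v * t v ^ 2 ∂stdGaussian E) - linearizedKernelForm t t ∧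
        c * (∫ v, collisionFrequency v * t v ^ 2 ∂stdGaussian E) ≤
          (∫ v, collisionFrequency v * t v ^ 2 ∂stdGaussian E) - linearizedKernelForm t t := by
  obtain ⟨lam, hlam, hgap⟩ := le_neg_maxwellianInner_hardSphereLinearizedOp_of_orthogonal_holds
    (E := E) hE
  set CK : ℝ := (kernelConst hE).toReal with hCK
  have hCK0 : 0 ≤ CK := ENNReal.toReal_nonneg
  refine ⟨lam, lam / (lam + CK), hlam, div_pos hlam (by positivity),
    (div_le_one (by positivity)).2 (by linarith), fun t ht horth => ?_⟩
  have htL : MemLp t 2 (stdGaussian E) := memLp_two_of_hasTemperateGrowth ht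
  have hQ := hgap t ht horth
  rw [neg_maxwellianInner_hardSphereLinearizedOp_eq hE ht] at hQ
  refine ⟨hQ, ?_⟩
  set Q : ℝ := (∫ v, collisionFrequency v * t v ^ 2 ∂stdGaussian E) - linearizedKernelForm t t
    with hQdef
  set W : ℝ := ∫ v, collisionFrequency v * t v ^ 2 ∂stdGaussian E with hW
  set a : ℝ := maxwellianInner t t with ha
  -- `|⟪t, K t⟫| ≤ C_K a`
  have hnorm : (eLpNorm t 2 (stdGaussian E)).toReal ^ 2 = a := by
    rw [← Lp.norm_toLp t htL, norm_toLp_sq_eq_maxwellianInner htL]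
  have hKa : linearizedKernelForm t t ≤ CK * a := by
    have h := abs_linearizedKernelForm_le hE htL htL
    rw [mul_assoc, ← pow_two, hnorm] at h
    exact (le_abs_self _).trans h
  have h2 : W - CK * a ≤ Q := by rw [hQdef]; linarith
  -- convex combination
  rw [div_mul_eq_mul_div, div_le_iff₀ (by positivity)]
  nlinarith [mul_le_mul_of_nonneg_left hQ hCK0, mul_le_mul_of_nonneg_left h2 hlam.le]

/-! ### The kernel part on collision invariants -/

/-- **`K [n] = [ν n]` for a collision invariant `n`** (`L n = 0` and `L n = ∫∫ B (n' + n_*' - n_*) - ν n`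
pointwise). [folklore] -/
theorem gainLossOp_toLp_of_mem_collisionInvariants (hE : 2 ≤ finrank ℝ E) {n : E → ℝ}
    (hn : n ∈ collisionInvariants E) :
    gainLossOp hE ((memLp_two_of_hasTemperateGrowth (collisionInvariants_le_temperateGrowth hn)).toLp n) =
      (memLp_two_collisionFrequency_mul_of_hasTemperateGrowth
        (collisionInvariants_le_temperateGrowth hn)).toLp (fun v => collisionFrequency v * n v) := by
  have hn' : n.HasTemperateGrowth := collisionInvariants_le_temperateGrowth hn
  rw [gainLossOp_toLp hE hn']
  refine MemLp.toLp_congr _ _ (Eventually.of_forall fun v => ?_)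
  have h0 : hardSphereLinearizedOp n v = 0 := by
    have := linearizedCollisionOp_eq_zero_of_isCollisionInvariant (E := E) hardSphereKernel
      (isCollisionInvariant_of_mem_collisionInvariants hn)
    exact congrFun this v
  have h1 := hardSphereLinearizedOp_eq_kernel_sub hn' v
  rw [h0] at h1
  linarith

/-! ### Orthogonal projection onto the collision invariants -/

/-- **Orthogonal decomposition against the collision invariants**: every `φ ∈ L²(M dv)` is
`n + (φ - n)` with `n` a collision invariant and `φ - n` `M`-orthogonal to all collision
invariants (orthogonal projection, in `L²(M dv)`, onto the finite-dimensional subspace of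
classes of the functions `a + ⟪b, v⟫ + c |v|²`). [folklore] -/
theorem exists_sub_mem_collisionInvariants_orthogonal {φ : E → ℝ}
    (hφ : MemLp φ 2 (stdGaussian E)) :
    ∃ n ∈ collisionInvariants E, ∀ m ∈ collisionInvariants E,
      ∫ v, (φ v - n v) * m v ∂stdGaussian E = 0 := by
  -- the quadratic functions and their classes, linearly in the parameters
  have hquad : ∀ p : (ℝ × ℝ) × E,
      (fun v : E => p.1.1 + ⟪p.2, v⟫_ℝ + p.1.2 * ‖v‖ ^ 2) ∈ collisionInvariants E := fun p =>
    mem_collisionInvariants_iff.2 ⟨p.1.1, p.1.2, p.2, rfl⟩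
  have hmem : ∀ p : (ℝ × ℝ) × E,
      MemLp (fun v : E => p.1.1 + ⟪p.2, v⟫_ℝ + p.1.2 * ‖v‖ ^ 2) 2 (stdGaussian E) := fun p =>
    memLp_two_of_hasTemperateGrowth (collisionInvariants_le_temperateGrowth (hquad p))
  let Ψ : (ℝ × ℝ) × E →ₗ[ℝ] Lp ℝ 2 (stdGaussian E) :=
    { toFun := fun p => (hmem p).toLp _
      map_add' := fun p q => by
        rw [← MemLp.toLp_add (hmem p) (hmem q)]
        refine MemLp.toLp_congr _ _ (Eventually.of_forall fun v => ?_)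
        simp only [Prod.fst_add, Prod.snd_add, Pi.add_apply, inner_add_left]
        ring
      map_smul' := fun c p => by
        rw [RingHom.id_apply, ← MemLp.toLp_const_smul c (hmem p)]
        refine MemLp.toLp_congr _ _ (Eventually.of_forall fun v => ?_)
        simp only [Prod.smul_fst, Prod.smul_snd, smul_eq_mul, Pi.smul_apply, real_inner_smul_left]
        ring }
  set N : Submodule ℝ (Lp ℝ 2 (stdGaussian E)) := LinearMap.range Ψ with hN
  haveI : FiniteDimensional ℝ N := LinearMap.finiteDimensional_range Ψ
  haveI : CompleteSpace N := FiniteDimensional.complete ℝ N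
  -- project
  set f : Lp ℝ 2 (stdGaussian E) := hφ.toLp φ with hf
  obtain ⟨p, hp⟩ : ∃ p, Ψ p = N.starProjection f :=
    LinearMap.mem_range.1 (N.starProjection_apply_mem f)
  refine ⟨_, hquad p, fun m hm => ?_⟩
  obtain ⟨a, c, b, rfl⟩ := mem_collisionInvariants_iff.1 hm
  have hmN : Ψ ((a, c), b) ∈ N := LinearMap.mem_range_self Ψ _
  have horth : ⟪f - N.starProjection f, Ψ ((a, c), b)⟫_ℝ = 0 :=
    Submodule.inner_left_of_mem_orthogonal hmN (N.sub_starProjection_mem_orthogonal f)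
  rw [← hp, L2.inner_def] at horth
  rw [← horth]
  refine integral_congr_ae ?_
  have hΨ : ∀ q : (ℝ × ℝ) × E, (Ψ q : E → ℝ) =ᵐ[stdGaussian E]
      fun v : E => q.1.1 + ⟪q.2, v⟫_ℝ + q.1.2 * ‖v‖ ^ 2 := fun q => MemLp.coeFn_toLp (hmem q)
  filter_upwards [Lp.coeFn_sub f (Ψ p), MemLp.coeFn_toLp hφ, hΨ p, hΨ ((a, c), b)]
    with v h1 h2 h3 h4
  rw [h1, Pi.sub_apply, h2, h3, h4]
  simp only [RCLike.inner_apply, conj_trivial]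
  ring

end

end Literature.Analysis.UnboundedOperators
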